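import Summits.QuantumFields.YangMills.Theorems.BalabanUVNodesK0FlatPortKernelRowsSepP
import Summits.QuantumFields.YangMills.Theorems.BalabanUVNodesK0FlatHBBound164P
import Summits.QuantumFields.YangMills.Theorems.UnitScaleTiltProp8FlatCubeSequenceAdm
import Summits.QuantumFields.YangMills.Theorems.UnitScaleTiltProp8HalvingQuarterCubeSeq
import HarnessLib

/-!
# K0⁷ `stub_prop8StepCoP13` (stmt-QuantumFields-20541), sub-target S5 — **THE REPAIRED S5 SOCKET (LOCATED-S5-2): [Balaban1985Variational] (164) FOR THE CANONICAL FLAT `H` OF THE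
# ALIGNED CUBE SEQUENCE (144) ON NODE 00's FOUR-TORI, WITH THE GEOMETRY (144)∕[Balaban1984PropagatorsII] (2.60) AND THE SMALLNESS (163) DISCHARGED** — what remains are EXACTLY
# the data bounds (160) (near cells, in the PHYSICAL distance `distBI`) and (155) (far cells, at the class radius of their own level), the comparability of the radii, the
# level weights' defining equation, and ONE displayed smallness of the core collar `8C_d·C·B₃·e^{−δ₁(ρ−ρ₀−1)} ≤ θ` (print: «R₁M₁ sufficiently big»)

Cell `pub-ymgap`, width seat `pub-ymgap-k0-s1-w3` gen 3 (D-0149; START LIST v8 §k0-s1; bus LOCATED-S5-2 + CLAIM-1 INBOX l.27620).  `--kind proof --supports stmt-QuantumFields-20541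
--as helper`; count-neutral; def-free.  WHY: the g2 socket `K0S5HBRowsAtRecordTori.hbRows164_levelRadii_cubeSeq_T4` (p597524) leaves inside its far-cell hypothesis the two
GEOMETRIC clauses `R′ ≤ dBI b c` ((144)) and `G·(k − j(c) − g) ≤ dBI b c` ((2.60)) against an existentially hidden `dBI ≥ distBI`; the second is not dischargeable from `distBI ≤ dBI`
(LOCATED-S5-2).  File P11 (`K0FlatPortKernelRowsSepP.hRowsSep_of_adm22_T4`) now exports the level separation `(R·L·M_h − 1)·(i − j(c) − 1) ≤ dBI b c` (`b₋ ∈ Ω_i`); THIS FILE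
discharges BOTH clauses at the aligned cube sequence `cubeSeqM x₀ k hk ρ S (L·M_h)` for observation bonds `b` in the CORE (`dist_k(B^k b₋, B^k x₀) ≤ ρ₀ ≤ ρ`), eliminates the
tilt (`τ := ¼δ₀`, the threshold `R₀` raised so that `e^{¼δ₀(R·L·M_h − 1)} ≥ 2`), and hands the S6 assembly (dag-n07-w4) the four rows of (164) behind data-only hypotheses.

THE PRINT ([Balaban1985Variational] pp. 300, 303–304 [PDF 24, 27–28]): *«□₀ ⊃ □₁ ⊃ … ⊃ □_k ⊃ □, dist(□_{n+1}, □_nᶜ) = R₁M₁Lⁿη, n = 0, 1, …, k (144) … |B(⟨x, x′⟩)| < (8d²L² + 4L²|x − y|)ε₁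
(160) … |HB|, … ≦ B₀ Σ_{c∈ℭ_k} e^{−δ₀d(y₁,c₋)}(L^{j(c)}η)⁻¹|B(c)| (161) … We may assume that R₁M₁ is sufficiently big, so that B₃e^{−½δ₀R₁M₁} ≦ ½ (163). Then we get on Δ |HB|,
|∇^ηHB|, |∂^{η*}∂^ηHB|, |Δ^ηHB| < ¼M_Δ max{B₃ε₁, ½ε₀} (164)»*; p. 303 line 3: *«|y₂ − y| ≤ d(y₁, y₂) + 3d²M_Δ»* (physical distance ≤ multiscale distance).  [Balaban1984PropagatorsII]
p. 234 (2.60): *«e^{−αδ₀d(y,y′)} ≤ e^{−αδ₀RM max{|j−j′|−1,0}}»*.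

WHAT IS PROVED (sorry-free; axioms standard; no definition).  §1 `inOm_top_of_core` (any carrier `P : Params`: the core — fine sites within `ρ₀ ≤ ρ` top-level blocks of
`x₀` — lies in `Ω_k = □_k` of ym3-torus's aligned cube sequence).  §2 ARITHMETIC of the tilt and of «R₁M₁ sufficiently big»: `two_le_exp_quarter`, `h163_of_core`,
`exists_collar_threshold` (`A ≥ 0`, `θ > 0`, `δ₁ > 0` ⇒ `∃ R₁, ∀ t ≥ R₁, A·e^{−δ₁t} ≤ θ`).  §3 ★★★ `hbRows164_core_of_adm22_T4 (F : T4Family)` — AT EVERY ADMISSIBLE FAMILY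
(dag-n07-w4's ASK I.27845: the S6 HEAD keys on its own inhabitant of (144), dag-n07-e's `cubeDomains`): there are `M_h⁰, R₀ : ℕ` and `C ≥ 0`, `δ₀ > 0`, `δ₁ > 0`, `B₃ > 0` such that
for all heights `1 ≤ K − n`, `K − n + 1 ≤ F.m + K`, `M_h = L^{a′} ≥ M_h⁰`, `R ≥ R₀`, `a′ + 3 ≤ F.m + n`, every `D : Domains (F.P K)` with `D.k = K − n`, `Adm22 D R (L·M_h)`, every
level-weight family `w`, all `C_d, M_Δ, ε₁ ≥ 0`, radii `ε` (`0 ≤ ε(K − n)`, `ε j ≤ 2ε(j+1)`), every core collar `R′` and far coefficient `θ` with `8C_d·C·B₃·e^{−δ₁R′} ≤ θ`, every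
observation bond `b` with `D.InOm (K − n) b₋` whose lower-level index bonds satisfy `R′ ≤ distBI D b c` ((144) at `n = k`, PHYSICAL distance — the consumer's tower geometry), and
every datum `X` with NEAR (top-level) cells `|X c| ≤ C_d·M_Δ·ε₁·(distBI D b c + 1)` ((160)) and FAR cells (`j(c) < K − n`) `|X c| ≤ C_d·M_Δ·ε(j(c))·L^{K−n−j(c)}` ((155)): the four
left-weighted rows `|HX|`, `∇^ηHX` (all four directions), `∂^{η*}∂^ηHX`, `Δ^ηHX` of the canonical `H := flatH (F.P K) (K − n) D` at `b` are `≤ ¼M_Δ·max{4C_dCB₃·ε₁, θ·ε(K − n)}` — the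
(2.60) clause is discharged INSIDE by P11's exported separation (`G = R·L·M_h − 1`, `g = 1`), the tilt `τ = ¼δ₀` eliminated (`R₀` raised so that `e^{¼δ₀G} ≥ 2`; `δ₁ = ¼δ₀`);
★ `hbRows164_uniform_core_of_adm22_T4` — PRINT'S UNIFORM FAR RADIUS `ε ≡ ε₀` (the reading (β) of dag-n07-w4's LOCATED-H60-1: the tower lies in `Ω_{i−1}`, so (151)∕(155) carry one
radius): far cells `|X c| ≤ C_d·M_Δ·ε₀·L^{K−n−j(c)}`, rows `≤ ¼M_Δ·max{4C_dCB₃·ε₁, θ·ε₀}`.  §4 ★★ `hbRows164_core_cubeSeq_T4` ∕ ★ `hbRows164_uniform_core_cubeSeq_T4` — the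
instances at `D := cubeSeqM x₀ (K − n) hk ρ S (L·M_h)` (`S ≥ R·L·M_h`, `Adm22` by `adm22_cubeSeqM`) for bonds in the CORE `dist_{K−n}(B^{K−n}b₋, B^{K−n}x₀) ≤ ρ₀ ≤ ρ`: top-domain
membership (`inOm_top_of_core`) and core collar `R′ := ρ − ρ₀ − 1` (`HalvingQuarterCubeSeq.distBI_ge_of_level_lt`, BY NAME) DISCHARGED — hypotheses = data (160)∕(155) + weights +
`8C_d·C·B₃·e^{−δ₁(ρ − ρ₀ − 1)} ≤ θ`.  The S6 budget token's S5 letters: `C := ¼M_Δ·4C_dCB₃`, `θ′ := ¼M_Δθ`.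
HONEST SCOPE: the DATA (160)∕(155) (S3: the (7)-data and `V₁ = e^{iB}` on the collar cells), the choice of `x₀`∕`ρ₀`∕`ρ` at the record's core plaquette (dag-n07-w4's recipe
`center_mem_cubeSet`) and the level weights are the consumer's; the content behind the letters is lit-balaban's kernel-checked [Balaban1984PropagatorsII] chain (Cor. 2.8, Prop. 2.7,
Prop. 2.6, Lemma 2.1, the walk form of (2.2)) read through files P3∕P8∕P11.  Count-neutral; K0⁷ OPEN; N07 NOT discharged (5∕27 unmoved); one finite 𝕋⁴ programme at fixed ε — R4
closes the conditional finite-𝕋⁴ rung `BalabanLadder.UV` only; the YM mass gap (Clay) is NOT proved by any of this; nothing continuum ∕ ℝ⁴ ∕ OS.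

References: T. Bałaban, CMP **102** (1985) 277–309 [Balaban1985Variational] (144) p.300, (155) p.302, (160)–(163) p.303, (164)–(165) p.304; CMP **96** (1984) 223–250
[Balaban1984PropagatorsII] (2.1)–(2.2) p.224, (2.46) p.231, (2.60) p.234, Cor. 2.8 (2.150)–(2.151) p.249; CMP **109** (1987) 249–301 [Balaban1987RG1] (0.1) p.251.
-/

set_option autoImplicit false

noncomputable section

open scoped BigOperators

namespace Summit.QuantumFields.YangMills.Theorems.K0S5HBRows164CoreCubeSeq

open Literature.MathematicalPhysics.QuantumFieldTheory.Balaban1983to89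
open B5Eq117TorusCarriers (Mk)
open B5Eq118OneStroke (iterBlockOf iterBlockOf_succ iterBlockOf_zero)
open B5Prop12FieldsLattice (distSite distSite_self distSite_nonneg)
open B5RowSumsP12Lattice (distSite_comm distSite_triangle)
open B6SectADomainsV1 (Domains)
open B6SectAOperatorsV1 (BondIdx dcE dcsE)
open T4Continuum (T4Family)
open Summit.QuantumFields.YangMills.Theorems.FlatCubeOpsText (Adm22 distBI)
open Summit.QuantumFields.YangMills.Theorems.K0FlatCubeOpsTextP (IsLevWeight flatH levWeight_nonneg)
open Summit.QuantumFields.YangMills.Theorems.K0FlatPortKernelRowsSepP (hRowsSep_of_adm22_T4)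
open Summit.QuantumFields.YangMills.Theorems.K0FlatHBBound164P (rows164_quarter_levelRadii_of_comparable bondIdx_level_le)
open Summit.QuantumFields.YangMills.Theorems.FlatCubeSequenceAligned (radM cubeFinM cubeSeqM cubeSeqM_Om_pos mem_cubeFinM_of_dist)
open Summit.QuantumFields.YangMills.Theorems.FlatCubeSequenceAdm (adm22_cubeSeqM)
open Summit.QuantumFields.YangMills.Theorems.HalvingQuarterCubeSeq (distBI_ge_of_level_lt distBI_nonneg)

/-! ## §1 The core lies in the top cube (the far geometry of (144) is `HalvingQuarterCubeSeq.distBI_ge_of_level_lt`, by name) -/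

section Geometry

variable {P : Params}

/-- **THE CORE LIES IN `Ω_k = □_k`**: a fine site within `ρ₀ ≤ ρ` top-level blocks of the centre belongs to `Ω_k` of the aligned cube sequence (`1 ≤ k`).
[cite: Balaban1985Variational, (144) p.300; Balaban1984PropagatorsII, (2.1) p.224] -/
theorem inOm_top_of_core (x₀ : Site P 0) {k : ℕ} (hk : k ≤ P.m + P.K) {ρ ρ₀ : ℕ} (S M : ℕ) (hM : 1 ≤ M) (hk1 : 1 ≤ k) (hρ : ρ₀ ≤ ρ)
    {x : Site P 0} (hx : distSite (Mk P k) (iterBlockOf k x) (iterBlockOf k x₀) ≤ (ρ₀ : ℝ)) :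
    (cubeSeqM x₀ k hk ρ S M hM).InOm k x := by
  unfold Domains.InOm
  rw [cubeSeqM_Om_pos x₀ hk ρ S M hM hk1 le_rfl]
  refine mem_cubeFinM_of_dist x₀ k ρ S M k ?_
  rw [Nat.sub_self]
  have hρ' : (ρ₀ : ℝ) ≤ (ρ : ℝ) := by exact_mod_cast hρ
  exact hx.trans (hρ'.trans (le_of_eq rfl))

end Geometry

/-! ## §2 Arithmetic of the tilt `τ = ¼δ₀` and of «R₁M₁ sufficiently big» -/

/-- `4·log 2∕δ₀ ≤ G` and `δ₀ > 0` ⇒ `2 ≤ e^{¼δ₀·G}`. [folklore] -/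
theorem two_le_exp_quarter {δ₀ G : ℝ} (hδ₀ : 0 < δ₀) (hG : 4 * Real.log 2 / δ₀ ≤ G) : 2 ≤ Real.exp (δ₀ / 4 * G) := by
  have hlog : Real.log 2 ≤ δ₀ / 4 * G := by
    have h := mul_le_mul_of_nonneg_left hG (by positivity : (0 : ℝ) ≤ δ₀ / 4)
    have e : δ₀ / 4 * (4 * Real.log 2 / δ₀) = Real.log 2 := by field_simp
    linarith
  calc (2 : ℝ) = Real.exp (Real.log 2) := (Real.exp_log two_pos).symm
    _ ≤ Real.exp (δ₀ / 4 * G) := Real.exp_le_exp.2 hlog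

/-- the displayed core-collar smallness `8C_dCB₃e^{−¼δ₀R′} ≤ θ` is (163′) at `τ = ¼δ₀`, `g = 1`. [cite: Balaban1985Variational, (163) p.303, bookkeeping] -/
theorem h163_of_core {Cd C B₃ δ₀ R' θ : ℝ} (h : 8 * Cd * C * B₃ * Real.exp (-(δ₀ / 4 * R')) ≤ θ) :
    4 * Cd * C * B₃ * (Real.exp (-((δ₀ / 2 - δ₀ / 4) * R')) * (2 : ℝ) ^ (1 : ℕ)) ≤ θ := by
  have e : δ₀ / 2 - δ₀ / 4 = δ₀ / 4 := by ring
  rw [e, pow_one]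
  calc 4 * Cd * C * B₃ * (Real.exp (-(δ₀ / 4 * R')) * 2) = 8 * Cd * C * B₃ * Real.exp (-(δ₀ / 4 * R')) := by ring
    _ ≤ θ := h

/-- **«R₁M₁ SUFFICIENTLY BIG» IS ALWAYS AVAILABLE**: for `A ≥ 0`, `θ > 0`, `δ₁ > 0` there is a collar width `R₁ : ℕ` with `A·e^{−δ₁t} ≤ θ` for all `t ≥ R₁` — the consumer's
discharge of the displayed smallness of §3 (take `ρ ≥ ρ₀ + 1 + R₁`). [cite: Balaban1985Variational, (163) p.303, bookkeeping] -/
theorem exists_collar_threshold {A θ δ₁ : ℝ} (hA : 0 ≤ A) (hθ : 0 < θ) (hδ₁ : 0 < δ₁) :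
    ∃ R₁ : ℕ, ∀ t : ℝ, (R₁ : ℝ) ≤ t → A * Real.exp (-(δ₁ * t)) ≤ θ := by
  refine ⟨⌈Real.log (A / θ) / δ₁⌉₊, fun t ht => ?_⟩
  have hceil : Real.log (A / θ) / δ₁ ≤ t := (Nat.le_ceil _).trans ht
  have hlog : Real.log (A / θ) ≤ δ₁ * t := by
    have := mul_le_mul_of_nonneg_left hceil hδ₁.le
    rwa [mul_div_cancel₀ _ hδ₁.ne'] at this
  rcases eq_or_lt_of_le hA with hA0 | hApos
  · rw [← hA0, zero_mul]; exact hθ.le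
  · have hAθ : 0 < A / θ := div_pos hApos hθ
    have hexp : Real.exp (-(δ₁ * t)) ≤ θ / A := by
      rw [Real.exp_neg]
      have h1 : A / θ ≤ Real.exp (δ₁ * t) := by
        calc A / θ = Real.exp (Real.log (A / θ)) := (Real.exp_log hAθ).symm
          _ ≤ Real.exp (δ₁ * t) := Real.exp_le_exp.2 hlog
      calc (Real.exp (δ₁ * t))⁻¹ ≤ (A / θ)⁻¹ := inv_anti₀ hAθ h1
        _ = θ / A := by rw [inv_div]
    calc A * Real.exp (-(δ₁ * t)) ≤ A * (θ / A) := mul_le_mul_of_nonneg_left hexp hA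
      _ = θ := by field_simp

/-! ## §3 The repaired S5 socket at EVERY admissible family (the S6 HEAD keys on its own inhabitant of (144), dag-n07-w4 ASK I.27845) -/

/-- ★★★ **(164) FOR THE CANONICAL FLAT `H` OF EVERY (2.1)–(2.2)-ADMISSIBLE NESTED FAMILY ON NODE 00's FOUR-TORI — THE (2.60) LAYER SEPARATION DISCHARGED, THE (144) CORE COLLAR IN THE
PHYSICAL DISTANCE, THE TILT ELIMINATED** (LOCATED-S5-2 ∕ dag-n07-w4's LOCATED-H60-1 repaired; binder shape of P10's `hbRows164_levelRadii_of_adm22_T4`): for every `F : T4Family`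
there are `M_h⁰, R₀ : ℕ` and `C ≥ 0`, `δ₀ > 0`, `δ₁ > 0`, `B₃ > 0` such that for all heights `1 ≤ K − n`, `K − n + 1 ≤ F.m + K`, big blocks `M_h = L^{a′} ≥ M_h⁰`, `R ≥ R₀`,
`a′ + 3 ≤ F.m + n`, EVERY `D : Domains (F.P K)` with `D.k = K − n`, `Adm22 D R (L·M_h)`, every level-weight family `w`, all `C_d, M_Δ, ε₁ ≥ 0`, radii `ε` (`0 ≤ ε(K−n)`,
`ε j ≤ 2ε(j+1)`), every core collar `R′` and far coefficient `θ` with `8C_d·C·B₃·e^{−δ₁R′} ≤ θ`, every observation bond `b` IN THE TOP DOMAIN (`D.InOm (K − n) b₋`) whose lower-level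
index bonds are `R′`-far IN THE PHYSICAL DISTANCE (`j(c) < K − n → R′ ≤ distBI D b c` — (144) at `n = k`, the consumer's tower geometry; for ym3-torus's `cubeSeqM` it is
`HalvingQuarterCubeSeq.distBI_ge_of_level_lt`, §4), and every datum `X` with NEAR (top-level) cells `|X c| ≤ C_d·M_Δ·ε₁·(distBI D b c + 1)` ((160)) and FAR cells
`|X c| ≤ C_d·M_Δ·ε(j(c))·L^{K−n−j(c)}` ((155)): the four left-weighted rows `|HX|`, `∇^ηHX` (all four directions), `∂^{η*}∂^ηHX`, `Δ^ηHX` of `H := flatH (F.P K) (K − n) D` at `b` are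
`≤ ¼M_Δ·max{4C_dCB₃·ε₁, θ·ε(K − n)}`.  The (2.60) clause `(R·L·M_h − 1)·((K−n) − j(c) − 1) ≤ dBI b c` of the level-radii junction is discharged INSIDE by P11's exported separation,
the tilt is `τ = ¼δ₀` with `R₀` raised so that `e^{¼δ₀(R·L·M_h − 1)} ≥ 2`, and `δ₁ = ¼δ₀`.
[cite: Balaban1985Variational, (144) p.300, (155) p.302, (160)–(164) pp.303–304; Balaban1984PropagatorsII, (2.1)–(2.2) p.224, (2.46) p.231, (2.60) p.234, Cor. 2.8 (2.150)–(2.151) p.249; Balaban1987RG1, (0.1) p.251] -/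
theorem hbRows164_core_of_adm22_T4 (F : T4Family) :
    ∃ (Mh₀ R₀ : ℕ) (C δ₀ δ₁ B₃ : ℝ), 0 ≤ C ∧ 0 < δ₀ ∧ 0 < δ₁ ∧ 0 < B₃ ∧
    ∀ (n K : ℕ) (_ : 1 ≤ K - n) (_ : K - n + 1 ≤ F.m + K) {Mh R a' : ℕ} (_ : Mh = F.L ^ a') (_ : Mh₀ ≤ Mh) (_ : R₀ ≤ R) (_ : a' + 3 ≤ F.m + n)
      (D : Domains (F.P K)) (_ : D.k = K - n) (_ : Adm22 D R (F.L * Mh))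
      (w : ℕ → PBond (F.P K) 0 → ℝ) (_ : IsLevWeight (F.P K) (K - n) D w)
      {Cd MΔ ε₁ θ R' : ℝ} {ε : ℕ → ℝ}
      (_ : 0 ≤ Cd) (_ : 0 ≤ MΔ) (_ : 0 ≤ ε₁) (_ : 0 ≤ ε (K - n)) (_ : ∀ j, j < K - n → ε j ≤ 2 * ε (j + 1))
      (_ : 8 * Cd * C * B₃ * Real.exp (-(δ₁ * R')) ≤ θ)
      {X : BondIdx D → ℝ} {b : PBond (F.P K) 0}
      (_ : D.InOm (K - n) b.src) (_ : ∀ c : BondIdx D, (c.1.1 : ℕ) < K - n → R' ≤ distBI D b c)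
      (_ : ∀ c, (c.1.1 : ℕ) = K - n → |X c| ≤ Cd * MΔ * ε₁ * (distBI D b c + 1))
      (_ : ∀ c, (c.1.1 : ℕ) < K - n → |X c| ≤ Cd * MΔ * ε (c.1.1 : ℕ) * ((F.P K).L : ℝ) ^ ((K - n) - (c.1.1 : ℕ))),
      w 1 b * (w 1 b * |flatH (F.P K) (K - n) D X b|) ≤
        1 / 4 * MΔ * max (4 * Cd * C * B₃ * ε₁) (θ * ε (K - n)) ∧
      (∀ ν : Fin (F.P K).d, w 1 b * (w 2 b * ((F.P K).L : ℝ) ^ (K - n) *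
          |flatH (F.P K) (K - n) D X ⟨b.src.shift ν, b.dir⟩ -
            flatH (F.P K) (K - n) D X b|) ≤
        1 / 4 * MΔ * max (4 * Cd * C * B₃ * ε₁) (θ * ε (K - n))) ∧
      w 1 b * (w 3 b * |(dcsE (((F.P K).L : ℝ) ^ (K - n)) (dcE (((F.P K).L : ℝ) ^ (K - n))
          (WithLp.toLp 2 (flatH (F.P K) (K - n) D X)))) b|) ≤
        1 / 4 * MΔ * max (4 * Cd * C * B₃ * ε₁) (θ * ε (K - n)) ∧
      w 1 b * (w 3 b * (((F.P K).L : ℝ) ^ (K - n)) ^ 2 *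
          |∑ ν : Fin (F.P K).d, ((flatH (F.P K) (K - n) D X b -
              flatH (F.P K) (K - n) D X ⟨b.src.shift ν, b.dir⟩) +
            (flatH (F.P K) (K - n) D X b -
              flatH (F.P K) (K - n) D X ⟨b.src.unshift ν, b.dir⟩))|) ≤
        1 / 4 * MΔ * max (4 * Cd * C * B₃ * ε₁) (θ * ε (K - n)) := by
  obtain ⟨Mh₀, R₀, C, δ₀, B₃, hC, hδ₀, hB₃, hmain⟩ := hRowsSep_of_adm22_T4 F
  refine ⟨Mh₀, max R₀ (⌈4 * Real.log 2 / δ₀⌉₊ + 2), C, δ₀, δ₀ / 4, B₃, hC, hδ₀, div_pos hδ₀ four_pos, hB₃, ?_⟩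
  intro n K hk1 hk' Mh R a' hMha hMh hR hsize D hDk hAdm w hw Cd MΔ ε₁ θ R' ε hCd hMΔ hε₁ hεk hcomp h163 X b hbΩ hcollar hnear hfar
  have hR₀ : R₀ ≤ R := le_trans (le_max_left _ _) hR
  obtain ⟨-, -, dBI, hcompD, hsep, hrow, hdec⟩ := hmain n K hk1 hk' hMha hMh hR₀ hsize D hDk hAdm w hw
  -- `1 ≤ L·M_h` (as `M_h = L^{a′}`, `L ≥ 1`)
  have hM : 1 ≤ F.L * Mh := by
    rw [hMha]
    exact Nat.one_le_iff_ne_zero.mpr (Nat.mul_ne_zero (by have := F.hL11; omega) (pow_ne_zero _ (by have := F.hL11; omega)))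
  -- the per-layer gap `G₀ = R·L·M_h − 1` and the tilt `τ = ¼δ₀`
  set G₀ : ℝ := ((R * (F.L * Mh) - 1 : ℕ) : ℝ) with hG₀def
  have hRq : ⌈4 * Real.log 2 / δ₀⌉₊ + 2 ≤ R := le_trans (le_max_right _ _) hR
  have hRM : R ≤ R * (F.L * Mh) := Nat.le_mul_of_pos_right R hM
  have hnat : ⌈4 * Real.log 2 / δ₀⌉₊ + 1 ≤ R * (F.L * Mh) - 1 := by omega
  have hG₀ : 4 * Real.log 2 / δ₀ ≤ G₀ := by
    have h1 : (4 * Real.log 2 / δ₀ : ℝ) ≤ ⌈4 * Real.log 2 / δ₀⌉₊ := Nat.le_ceil _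
    have h2 : ((⌈4 * Real.log 2 / δ₀⌉₊ + 1 : ℕ) : ℝ) ≤ G₀ := by rw [hG₀def]; exact_mod_cast hnat
    push_cast at h2
    linarith
  have h2 : 2 ≤ Real.exp (δ₀ / 4 * G₀) := two_le_exp_quarter hδ₀ hG₀
  have hτ : (0 : ℝ) ≤ δ₀ / 4 := by positivity
  have hτδ : δ₀ / 4 ≤ δ₀ / 2 := by linarith
  have h163' := h163_of_core h163
  have hd0 : ∀ c, 0 ≤ dBI b c := fun c => (distBI_nonneg _ b c).trans (hcompD b c)
  refine rows164_quarter_levelRadii_of_comparable hdec hrow hC hB₃.le hCd hMΔ hε₁ hεk hcomp hτ hτδ h2 h163'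
    (fun c => (c.1.1 : ℕ) = K - n) (levWeight_nonneg hw 1 b) hd0 (bondIdx_level_le hDk) ?_ ?_
  · -- NEAR (top-level) cells: (160) in the physical distance `distBI ≤ dBI`, `L⁰ = 1`
    intro c hc
    have h := hnear c hc
    rw [hc, Nat.sub_self, pow_zero, mul_one]
    have hmono : Cd * MΔ * ε₁ * (distBI D b c + 1) ≤ Cd * MΔ * ε₁ * (dBI b c + 1) :=
      mul_le_mul_of_nonneg_left (by linarith [hcompD b c]) (by positivity)
    exact h.trans hmono
  · -- FAR cells: (155) at the cell's own level; (144) from the core collar in `distBI ≤ dBI`; (2.60) from the exported level separation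
    intro c hc
    have hlt : (c.1.1 : ℕ) < K - n := lt_of_le_of_ne (bondIdx_level_le hDk c) hc
    refine ⟨hfar c hlt, (hcollar c hlt).trans (hcompD b c), ?_⟩
    have h := hsep (K - n) b c le_rfl hbΩ hlt
    simpa [hG₀def] using h

/-- ★ **THE SAME WITH PRINT'S UNIFORM FAR RADIUS** (`ε ≡ ε₀`; road (β) of dag-n07-w4's LOCATED-H60-1: the local tower (144) of a cube at record level `i` lies in `Ω_{i−1}` — p. 300 «□̃ ⊂
B^{j−1}(Λ_{j−1}) ∪ B^j(Λ_j) ⊂ Ω_{j−1}» — so (151)∕(155) carry ONE radius `ε₀`, the record's at levels `i − 1`, `i`): at every admissible `D`, far cells `|X c| ≤ C_d·M_Δ·ε₀·L^{K−n−j(c)}`,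
conclusion `≤ ¼M_Δ·max{4C_dCB₃·ε₁, θ·ε₀}` (print: `θ = ½`). [cite: Balaban1985Variational, (144) p.300, (151)–(155) pp.301–302, (160)–(164) pp.303–304; Balaban1984PropagatorsII, (2.60) p.234] -/
theorem hbRows164_uniform_core_of_adm22_T4 (F : T4Family) :
    ∃ (Mh₀ R₀ : ℕ) (C δ₀ δ₁ B₃ : ℝ), 0 ≤ C ∧ 0 < δ₀ ∧ 0 < δ₁ ∧ 0 < B₃ ∧
    ∀ (n K : ℕ) (_ : 1 ≤ K - n) (_ : K - n + 1 ≤ F.m + K) {Mh R a' : ℕ} (_ : Mh = F.L ^ a') (_ : Mh₀ ≤ Mh) (_ : R₀ ≤ R) (_ : a' + 3 ≤ F.m + n)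
      (D : Domains (F.P K)) (_ : D.k = K - n) (_ : Adm22 D R (F.L * Mh))
      (w : ℕ → PBond (F.P K) 0 → ℝ) (_ : IsLevWeight (F.P K) (K - n) D w)
      {Cd MΔ ε₁ θ R' ε₀ : ℝ}
      (_ : 0 ≤ Cd) (_ : 0 ≤ MΔ) (_ : 0 ≤ ε₁) (_ : 0 ≤ ε₀)
      (_ : 8 * Cd * C * B₃ * Real.exp (-(δ₁ * R')) ≤ θ)
      {X : BondIdx D → ℝ} {b : PBond (F.P K) 0}
      (_ : D.InOm (K - n) b.src) (_ : ∀ c : BondIdx D, (c.1.1 : ℕ) < K - n → R' ≤ distBI D b c)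
      (_ : ∀ c, (c.1.1 : ℕ) = K - n → |X c| ≤ Cd * MΔ * ε₁ * (distBI D b c + 1))
      (_ : ∀ c, (c.1.1 : ℕ) < K - n → |X c| ≤ Cd * MΔ * ε₀ * ((F.P K).L : ℝ) ^ ((K - n) - (c.1.1 : ℕ))),
      w 1 b * (w 1 b * |flatH (F.P K) (K - n) D X b|) ≤
        1 / 4 * MΔ * max (4 * Cd * C * B₃ * ε₁) (θ * ε₀) ∧
      (∀ ν : Fin (F.P K).d, w 1 b * (w 2 b * ((F.P K).L : ℝ) ^ (K - n) *
          |flatH (F.P K) (K - n) D X ⟨b.src.shift ν, b.dir⟩ -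
            flatH (F.P K) (K - n) D X b|) ≤
        1 / 4 * MΔ * max (4 * Cd * C * B₃ * ε₁) (θ * ε₀)) ∧
      w 1 b * (w 3 b * |(dcsE (((F.P K).L : ℝ) ^ (K - n)) (dcE (((F.P K).L : ℝ) ^ (K - n))
          (WithLp.toLp 2 (flatH (F.P K) (K - n) D X)))) b|) ≤
        1 / 4 * MΔ * max (4 * Cd * C * B₃ * ε₁) (θ * ε₀) ∧
      w 1 b * (w 3 b * (((F.P K).L : ℝ) ^ (K - n)) ^ 2 *
          |∑ ν : Fin (F.P K).d, ((flatH (F.P K) (K - n) D X b -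
              flatH (F.P K) (K - n) D X ⟨b.src.shift ν, b.dir⟩) +
            (flatH (F.P K) (K - n) D X b -
              flatH (F.P K) (K - n) D X ⟨b.src.unshift ν, b.dir⟩))|) ≤
        1 / 4 * MΔ * max (4 * Cd * C * B₃ * ε₁) (θ * ε₀) := by
  obtain ⟨Mh₀, R₀, C, δ₀, δ₁, B₃, hC, hδ₀, hδ₁, hB₃, hmain⟩ := hbRows164_core_of_adm22_T4 F
  refine ⟨Mh₀, R₀, C, δ₀, δ₁, B₃, hC, hδ₀, hδ₁, hB₃, ?_⟩
  intro n K hk1 hk' Mh R a' hMha hMh hR hsize D hDk hAdm w hw Cd MΔ ε₁ θ R' ε₀ hCd hMΔ hε₁ hε₀ h163 X b hbΩ hcollar hnear hfar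
  exact hmain n K hk1 hk' hMha hMh hR hsize D hDk hAdm w hw (ε := fun _ => ε₀) hCd hMΔ hε₁ hε₀ (fun j _ => by linarith) h163 hbΩ hcollar hnear hfar

/-! ## §4 The instance at ym3-torus's aligned cube sequence `cubeSeqM` (core collar and top-domain membership DISCHARGED by its geometry) -/

/-- ★★ **(164) FOR THE FLAT `H` OF THE ALIGNED CUBE SEQUENCE (144)** — §3 at `D := cubeSeqM x₀ (K − n) hk ρ S (L·M_h)` (`S ≥ R·L·M_h`, `Adm22` by `adm22_cubeSeqM`) for observation
bonds in the CORE `dist_{K−n}(B^{K−n}b₋, B^{K−n}x₀) ≤ ρ₀ ≤ ρ`: the top-domain membership is `inOm_top_of_core` and the core collar is `R′ := ρ − ρ₀ − 1`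
(`HalvingQuarterCubeSeq.distBI_ge_of_level_lt`), so the ONLY remaining hypotheses are the data (160)∕(155), the weights' equation and `8C_d·C·B₃·e^{−δ₁(ρ − ρ₀ − 1)} ≤ θ`.
[cite: Balaban1985Variational, (144) p.300, (155) p.302, (160)–(164) pp.303–304; Balaban1984PropagatorsII, (2.1)–(2.2) p.224, (2.60) p.234; Balaban1987RG1, (0.1) p.251] -/
theorem hbRows164_core_cubeSeq_T4 (F : T4Family) :
    ∃ (Mh₀ R₀ : ℕ) (C δ₀ δ₁ B₃ : ℝ), 0 ≤ C ∧ 0 < δ₀ ∧ 0 < δ₁ ∧ 0 < B₃ ∧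
    ∀ (n K : ℕ) (_ : 1 ≤ K - n) (_ : K - n + 1 ≤ F.m + K) {Mh R a' : ℕ} (_ : Mh = F.L ^ a') (_ : Mh₀ ≤ Mh) (_ : R₀ ≤ R) (_ : a' + 3 ≤ F.m + n)
      (x₀ : Site (F.P K) 0) (hk : K - n ≤ (F.P K).m + (F.P K).K) (ρ ρ₀ S : ℕ) (_ : ρ₀ ≤ ρ) (hM : 1 ≤ F.L * Mh) (_ : R * (F.L * Mh) ≤ S)
      (w : ℕ → PBond (F.P K) 0 → ℝ) (_ : IsLevWeight (F.P K) (K - n) (cubeSeqM x₀ (K - n) hk ρ S (F.L * Mh) hM) w)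
      {Cd MΔ ε₁ θ : ℝ} {ε : ℕ → ℝ}
      (_ : 0 ≤ Cd) (_ : 0 ≤ MΔ) (_ : 0 ≤ ε₁) (_ : 0 ≤ ε (K - n)) (_ : ∀ j, j < K - n → ε j ≤ 2 * ε (j + 1))
      (_ : 8 * Cd * C * B₃ * Real.exp (-(δ₁ * ((ρ : ℝ) - ρ₀ - 1))) ≤ θ)
      {X : BondIdx (cubeSeqM x₀ (K - n) hk ρ S (F.L * Mh) hM) → ℝ} {b : PBond (F.P K) 0}
      (_ : distSite (Mk (F.P K) (K - n)) (iterBlockOf (K - n) b.src) (iterBlockOf (K - n) x₀) ≤ (ρ₀ : ℝ))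
      (_ : ∀ c, (c.1.1 : ℕ) = K - n → |X c| ≤ Cd * MΔ * ε₁ * (distBI (cubeSeqM x₀ (K - n) hk ρ S (F.L * Mh) hM) b c + 1))
      (_ : ∀ c, (c.1.1 : ℕ) < K - n → |X c| ≤ Cd * MΔ * ε (c.1.1 : ℕ) * ((F.P K).L : ℝ) ^ ((K - n) - (c.1.1 : ℕ))),
      w 1 b * (w 1 b * |flatH (F.P K) (K - n) (cubeSeqM x₀ (K - n) hk ρ S (F.L * Mh) hM) X b|) ≤
        1 / 4 * MΔ * max (4 * Cd * C * B₃ * ε₁) (θ * ε (K - n)) ∧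
      (∀ ν : Fin (F.P K).d, w 1 b * (w 2 b * ((F.P K).L : ℝ) ^ (K - n) *
          |flatH (F.P K) (K - n) (cubeSeqM x₀ (K - n) hk ρ S (F.L * Mh) hM) X ⟨b.src.shift ν, b.dir⟩ -
            flatH (F.P K) (K - n) (cubeSeqM x₀ (K - n) hk ρ S (F.L * Mh) hM) X b|) ≤
        1 / 4 * MΔ * max (4 * Cd * C * B₃ * ε₁) (θ * ε (K - n))) ∧
      w 1 b * (w 3 b * |(dcsE (((F.P K).L : ℝ) ^ (K - n)) (dcE (((F.P K).L : ℝ) ^ (K - n))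
          (WithLp.toLp 2 (flatH (F.P K) (K - n) (cubeSeqM x₀ (K - n) hk ρ S (F.L * Mh) hM) X)))) b|) ≤
        1 / 4 * MΔ * max (4 * Cd * C * B₃ * ε₁) (θ * ε (K - n)) ∧
      w 1 b * (w 3 b * (((F.P K).L : ℝ) ^ (K - n)) ^ 2 *
          |∑ ν : Fin (F.P K).d, ((flatH (F.P K) (K - n) (cubeSeqM x₀ (K - n) hk ρ S (F.L * Mh) hM) X b -
              flatH (F.P K) (K - n) (cubeSeqM x₀ (K - n) hk ρ S (F.L * Mh) hM) X ⟨b.src.shift ν, b.dir⟩) +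
            (flatH (F.P K) (K - n) (cubeSeqM x₀ (K - n) hk ρ S (F.L * Mh) hM) X b -
              flatH (F.P K) (K - n) (cubeSeqM x₀ (K - n) hk ρ S (F.L * Mh) hM) X ⟨b.src.unshift ν, b.dir⟩))|) ≤
        1 / 4 * MΔ * max (4 * Cd * C * B₃ * ε₁) (θ * ε (K - n)) := by
  obtain ⟨Mh₀, R₀, C, δ₀, δ₁, B₃, hC, hδ₀, hδ₁, hB₃, hmain⟩ := hbRows164_core_of_adm22_T4 F
  refine ⟨Mh₀, R₀, C, δ₀, δ₁, B₃, hC, hδ₀, hδ₁, hB₃, ?_⟩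
  intro n K hk1 hk' Mh R a' hMha hMh hR hsize x₀ hk ρ ρ₀ S hρ hM hRS w hw Cd MΔ ε₁ θ ε hCd hMΔ hε₁ hεk hcomp h163 X b hb hnear hfar
  exact hmain n K hk1 hk' hMha hMh hR hsize (cubeSeqM x₀ (K - n) hk ρ S (F.L * Mh) hM) rfl (adm22_cubeSeqM x₀ hk ρ hM hRS) w hw
    hCd hMΔ hε₁ hεk hcomp h163 (inOm_top_of_core x₀ hk S (F.L * Mh) hM hk1 hρ hb)
    (fun c hc => distBI_ge_of_level_lt x₀ hk ρ S (F.L * Mh) hM c hc b hb) hnear hfar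

/-- ★ **THE ALIGNED CUBE SEQUENCE WITH PRINT'S UNIFORM FAR RADIUS** (`ε ≡ ε₀`): far cells `|X c| ≤ C_d·M_Δ·ε₀·L^{K−n−j(c)}`, rows `≤ ¼M_Δ·max{4C_dCB₃·ε₁, θ·ε₀}`.
[cite: Balaban1985Variational, (144) p.300, (151)–(155) pp.301–302, (160)–(164) pp.303–304; Balaban1984PropagatorsII, (2.60) p.234] -/
theorem hbRows164_uniform_core_cubeSeq_T4 (F : T4Family) :
    ∃ (Mh₀ R₀ : ℕ) (C δ₀ δ₁ B₃ : ℝ), 0 ≤ C ∧ 0 < δ₀ ∧ 0 < δ₁ ∧ 0 < B₃ ∧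
    ∀ (n K : ℕ) (_ : 1 ≤ K - n) (_ : K - n + 1 ≤ F.m + K) {Mh R a' : ℕ} (_ : Mh = F.L ^ a') (_ : Mh₀ ≤ Mh) (_ : R₀ ≤ R) (_ : a' + 3 ≤ F.m + n)
      (x₀ : Site (F.P K) 0) (hk : K - n ≤ (F.P K).m + (F.P K).K) (ρ ρ₀ S : ℕ) (_ : ρ₀ ≤ ρ) (hM : 1 ≤ F.L * Mh) (_ : R * (F.L * Mh) ≤ S)
      (w : ℕ → PBond (F.P K) 0 → ℝ) (_ : IsLevWeight (F.P K) (K - n) (cubeSeqM x₀ (K - n) hk ρ S (F.L * Mh) hM) w)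
      {Cd MΔ ε₁ θ ε₀ : ℝ}
      (_ : 0 ≤ Cd) (_ : 0 ≤ MΔ) (_ : 0 ≤ ε₁) (_ : 0 ≤ ε₀)
      (_ : 8 * Cd * C * B₃ * Real.exp (-(δ₁ * ((ρ : ℝ) - ρ₀ - 1))) ≤ θ)
      {X : BondIdx (cubeSeqM x₀ (K - n) hk ρ S (F.L * Mh) hM) → ℝ} {b : PBond (F.P K) 0}
      (_ : distSite (Mk (F.P K) (K - n)) (iterBlockOf (K - n) b.src) (iterBlockOf (K - n) x₀) ≤ (ρ₀ : ℝ))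
      (_ : ∀ c, (c.1.1 : ℕ) = K - n → |X c| ≤ Cd * MΔ * ε₁ * (distBI (cubeSeqM x₀ (K - n) hk ρ S (F.L * Mh) hM) b c + 1))
      (_ : ∀ c, (c.1.1 : ℕ) < K - n → |X c| ≤ Cd * MΔ * ε₀ * ((F.P K).L : ℝ) ^ ((K - n) - (c.1.1 : ℕ))),
      w 1 b * (w 1 b * |flatH (F.P K) (K - n) (cubeSeqM x₀ (K - n) hk ρ S (F.L * Mh) hM) X b|) ≤
        1 / 4 * MΔ * max (4 * Cd * C * B₃ * ε₁) (θ * ε₀) ∧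
      (∀ ν : Fin (F.P K).d, w 1 b * (w 2 b * ((F.P K).L : ℝ) ^ (K - n) *
          |flatH (F.P K) (K - n) (cubeSeqM x₀ (K - n) hk ρ S (F.L * Mh) hM) X ⟨b.src.shift ν, b.dir⟩ -
            flatH (F.P K) (K - n) (cubeSeqM x₀ (K - n) hk ρ S (F.L * Mh) hM) X b|) ≤
        1 / 4 * MΔ * max (4 * Cd * C * B₃ * ε₁) (θ * ε₀)) ∧
      w 1 b * (w 3 b * |(dcsE (((F.P K).L : ℝ) ^ (K - n)) (dcE (((F.P K).L : ℝ) ^ (K - n))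
          (WithLp.toLp 2 (flatH (F.P K) (K - n) (cubeSeqM x₀ (K - n) hk ρ S (F.L * Mh) hM) X)))) b|) ≤
        1 / 4 * MΔ * max (4 * Cd * C * B₃ * ε₁) (θ * ε₀) ∧
      w 1 b * (w 3 b * (((F.P K).L : ℝ) ^ (K - n)) ^ 2 *
          |∑ ν : Fin (F.P K).d, ((flatH (F.P K) (K - n) (cubeSeqM x₀ (K - n) hk ρ S (F.L * Mh) hM) X b -
              flatH (F.P K) (K - n) (cubeSeqM x₀ (K - n) hk ρ S (F.L * Mh) hM) X ⟨b.src.shift ν, b.dir⟩) +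
            (flatH (F.P K) (K - n) (cubeSeqM x₀ (K - n) hk ρ S (F.L * Mh) hM) X b -
              flatH (F.P K) (K - n) (cubeSeqM x₀ (K - n) hk ρ S (F.L * Mh) hM) X ⟨b.src.unshift ν, b.dir⟩))|) ≤
        1 / 4 * MΔ * max (4 * Cd * C * B₃ * ε₁) (θ * ε₀) := by
  obtain ⟨Mh₀, R₀, C, δ₀, δ₁, B₃, hC, hδ₀, hδ₁, hB₃, hmain⟩ := hbRows164_core_cubeSeq_T4 F
  refine ⟨Mh₀, R₀, C, δ₀, δ₁, B₃, hC, hδ₀, hδ₁, hB₃, ?_⟩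
  intro n K hk1 hk' Mh R a' hMha hMh hR hsize x₀ hk ρ ρ₀ S hρ hM hRS w hw Cd MΔ ε₁ θ ε₀ hCd hMΔ hε₁ hε₀ h163 X b hb hnear hfar
  exact hmain n K hk1 hk' hMha hMh hR hsize x₀ hk ρ ρ₀ S hρ hM hRS w hw (ε := fun _ => ε₀) hCd hMΔ hε₁ hε₀
    (fun j _ => by linarith) h163 hb hnear hfar

end Summit.QuantumFields.YangMills.Theorems.K0S5HBRows164CoreCubeSeq

end
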